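import Literature.NumberTheory.Rogawski1990.ArchBouazizStableFamily      -- ★ p849717 (D2-P3): `stOrbFamH L νH fH S`, brings `ArchBouazizSpaceH`, `RegS`, `ArchSmooth₂`
import Literature.NumberTheory.Rogawski1990.ArchBouazizClassMap          -- ★ p851469 (this seat): `bzClassMap`, `BzLocalized` (the SURJ road's vocabulary)
import HarnessLib

/-!
# THE ASSEMBLY OF BOUAZIZ'S SURJECTIVITY FOR `H_∞ = U(1,1)^W × U(1)^W` FROM ITS LOCAL ORGANS: localisation on the stable-class space ⊕ local surjectivity at every base class ⊕
# additivity of the stable orbital family ⇒ `BouazizSurjOfForwardStatement` (Bouaziz 1994 Thm. 6.2.1 (i) p. 592, §5.1 p. 588 «il suffit de prouver le théorème dans un bon voisinage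
# de chaque élément semi-simple»; Varadarajan 1989 §6 p. 229)

Topic `NumberTheory/Rogawski1990`; namespace `Literature.NumberTheory.Rogawski1990`.  THEOREMS ONLY (no `def`, no instance, no notation, no axiom, no named fact, no `sorry`): the organs enter as HYPOTHESES at the fixed frame `(L, νH, jcH)` (their global
texts `…Statement : Prop` live in the binder's HOME skeleton; the print organ (Σ-WALL) is registered in the leaf).  Cell `pub/hodgecm-mathlib`, crux H413 (`stmt-HodgeConjecture-24833`), line LH3 (closer stub `stub_N9`, DIRECT ROAD), letter L3′ = `BouazizSurjectiveStatement`, split by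
RULING #22 (LH3-plan (g4), 2026-09-02T12:30:32Z) into FORWARD ⊕ SURJ-OF-FORWARD; this file is the SURJ-OF-FORWARD binder's assembly skeleton (S-ROAD CENSUS v1, (Σ7)).
Author LH10-p01 (g5) (binder∕assembler of record).  Count-neutral.

THE TARGET (leaf v10 text, RULING #22).  `BouazizSurjOfForwardStatement := ∀ L … νH … jcH, (∀ S w, w ∉ S → jcH S w ≠ 0) → (∀ fH, ArchSmooth₂ L fH → ArchBouazizSpaceH jcH (stOrbFamH L νH fH))
→ ∀ Ψ, ArchBouazizSpaceH jcH Ψ → ∃ fH, ArchSmooth₂ L fH ∧ ∀ S, Set.EqOn (stOrbFamH L νH fH S) (Ψ S) (RegS S)` — Bouaziz's «`J^st_G : D(U) → I^st(U)` est surjective» for the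
datum `jcH` of the forward half.

BOUAZIZ'S ROAD (ÉNS 27 §5.1 p. 588).  «Si JG est surjective sur une famille d'ouverts complètement invariants recouvrant U, … alors `JG(φ₁ + ⋯ + φₙ) = ψ`»: a G-invariant partition of
unity reduces surjectivity to a good neighbourhood of each semisimple element.  Here the stable classes of `H_∞` are read through the per-place CLASS MAP
`(S, c) ↦ (tr γ_w(c), det γ_w(c), e^{i c_{w,1}})_w` (§1: two chart points are stably conjugate iff their class data agree; the map is `2π`-periodic in the angles, flip- and
`negXAt`-invariant, and continuous), a family is LOCALISED at a base class `b` to radius `ε` when it vanishes at every chart point whose class is `ε`-far from `b` (§1 `BzLocalized`),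
and the organs are (§2, v3 — the cut-offs are applied to GENUINE families only, `J_G(χφ) = χ J_G(φ)`, so NO jump computation for cut-off members of `I^st` is needed):
* (Σ-PoU) `FiniteSmoothPartitionStatement` — finite smooth partitions of unity on a compact subset of a finite-dimensional space, subordinate to prescribed balls (Mathlib);
* (Σ-SUPP) `BzClassSupportStatement` — the classes of the support of a member of `ArchBouazizSpaceH jcH` lie in a compact set ((I₄) + `Circle.exp`);
* (Σ-MULT) `StOrbFamHClassMulStatement` — `stOrbFamH ((F ∘ cl_H)·fH) = (F ∘ bzClassMap S) · stOrbFamH fH` on `RegS S` for smooth class functions `F` (F0P3a-p04 (g25), (Σ4a));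
* (Σ-ADD) `StOrbFamHSumStatement` — `C_c^∞(H_∞)` is closed under finite sums and `stOrbFamH` is additive on the regular sets ((S-lin), LH3-p02 (g5));
* (Σ-REG) `BzLocalSurjRegularStatement` — local surjectivity in EQUALITY form at a base class with distinct block eigenvalues everywhere (`tr² ≠ 4 det`; F0P3a-p04 (g25), (Σ4b–d));
* (Σ-WALL) `BzLocalSurjWallStatement` — the same at a base class with a central block somewhere: THE PRINT ORGAN (RULING #23; Bouaziz §5.2 + [B1] Thm. 4.1.1).
§3 **`bouazizSurjOfForward_of_parts`** — PROVED: radii by cases on the base class, compact class-support, partition of unity, local pre-images, class-function multiples, sum.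
HONEST LABEL: L3′ stays XL∕PRINT-labelled (Bouaziz 1994 Thm. 6.2.1) until the organs are paid ((Σ-WALL) is PRINT); HC_CM is proved only modulo the 7 printed citations (2 remaining:
hLiu418 = stmt-HodgeConjecture-24832, h413 = stmt-HodgeConjecture-24833) until rung 0 closes; this file is an assembly and pays nothing by itself.

## References
* [Bouaziz1994IntegralesOrbitales] A. Bouaziz, *Intégrales orbitales sur les groupes de Lie réductifs*, Ann. Sci. ÉNS (4) 27 (1994) 573–609, §2.3 Lemme 2.3.1 (partition de l'unité
  invariante), §5.1 p. 588, §5.2, Thm. 6.2.1 (i) p. 592.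
* [Varadarajan1989] V. S. Varadarajan, *An Introduction to Harmonic Analysis on Semisimple Lie Groups*, Cambridge Stud. Adv. Math. 16 (1989), §6 p. 229 (`F_f = δ Δ_C v · ∫ u`).
* [Shelstad1979] D. Shelstad, *Characters and inner forms of a quasi-split group over ℝ*, Compositio Math. 39 (1979), §4 Thm. 4.7 p. 31, Lemma 4.8.
-/

set_option autoImplicit false

noncomputable section

open MeasureTheory NumberField NumberField.InfinitePlace Complex Set Function
open Literature.NumberTheory.Automorphic Literature.NumberTheory.Automorphic.UnitaryGroup Literature.NumberTheory.Automorphic.ArchCartan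
open scoped Classical ContDiff

namespace Literature.NumberTheory.Rogawski1990

/-! ## The assembly at a fixed frame `(L, νH, jcH)` (vocabulary ★ `ArchBouazizClassMap`: `bzClassMap S c : W → ℂ × ℂ × ℂ`) -/

section Assembly

variable (L : Type) [Field L] [NumberField L] [IsCMField L]
  [MeasurableSpace (↥(arch (↥(maximalRealSubfield L)) L (IsCMField.complexConj L) 2 (Matrix.of fun i j : Fin 2 => if i.val + j.val + 1 = 2 then (1 : L) else 0)) ×
      ↥(arch (↥(maximalRealSubfield L)) L (IsCMField.complexConj L) 1 (Matrix.of fun i j : Fin 1 => if i.val + j.val + 1 = 1 then (1 : L) else 0)))]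
  [BorelSpace (↥(arch (↥(maximalRealSubfield L)) L (IsCMField.complexConj L) 2 (Matrix.of fun i j : Fin 2 => if i.val + j.val + 1 = 2 then (1 : L) else 0)) ×
      ↥(arch (↥(maximalRealSubfield L)) L (IsCMField.complexConj L) 1 (Matrix.of fun i j : Fin 1 => if i.val + j.val + 1 = 1 then (1 : L) else 0)))]
  (νH : Measure (↥(arch (↥(maximalRealSubfield L)) L (IsCMField.complexConj L) 2 (Matrix.of fun i j : Fin 2 => if i.val + j.val + 1 = 2 then (1 : L) else 0)) ×
      ↥(arch (↥(maximalRealSubfield L)) L (IsCMField.complexConj L) 1 (Matrix.of fun i j : Fin 1 => if i.val + j.val + 1 = 1 then (1 : L) else 0))))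
  [νH.IsHaarMeasure] [νH.IsMulRightInvariant]

/-- **SURJ-OF-FORWARD FROM ITS ORGANS** — `BouazizSurjOfForwardStatement`'s conclusion at the frame `(L, νH, jcH)` from the six organs AT THAT FRAME: (Σ-PoU) finite smooth partitions of
unity on compact subsets of the class space, (Σ-SUPP) compact class-support of members of `ArchBouazizSpaceH jcH`, (Σ-MULT) class-function multipliers of genuine families,
(Σ-ADD) finite sums, (Σ-REG) local surjectivity in equality form at base classes with distinct block eigenvalues everywhere (`tr_w² ≠ 4 det_w`), (Σ-WALL) the same at base classes
with a central block somewhere (PRINT, RULING #23).  Proof: radii by cases on the base class, a compact `K` carrying the classes of `supp Ψ`, a finite smooth partition of unity `χ_i`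
subordinate to the balls with `Σ χ_i = 1` on `K`, local pre-images `fH_i` agreeing with `Ψ` on the `i`-th ball, their class-function multiples `fH′_i`, and `fH := Σ fH′_i`: on a regular
chart point with class in `K` every surviving term reads `χ_i(class) · Ψ`, summing to `Ψ`; off `K` both sides vanish — Bouaziz's §5.1 gluing `JG(φ₁ + ⋯ + φₙ) = ψ` with the cut-offs
moved onto the GENUINE families (`J_G(χφ) = χ J_G(φ)`), so no jump computation for cut-off members of `I^st` is needed. [cite: Bouaziz1994IntegralesOrbitales, §5.1 p. 588; Thm. 6.2.1 (i) p. 592]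
[cite: Varadarajan1989, §6 p. 229] -/
theorem bouazizSurjOfForward_of_parts (jcH : Finset {w : InfinitePlace L // IsComplex w} → {w : InfinitePlace L // IsComplex w} → ℂ)
    -- (Σ-PoU) finite smooth partitions of unity on a compact subset of the class space, subordinate to prescribed balls
    (hpou : ∀ K : Set ({w : InfinitePlace L // IsComplex w} → ℂ × ℂ × ℂ), IsCompact K → ∀ ε : ({w : InfinitePlace L // IsComplex w} → ℂ × ℂ × ℂ) → ℝ, (∀ b, 0 < ε b) →
      ∃ (n : ℕ) (b : Fin n → ({w : InfinitePlace L // IsComplex w} → ℂ × ℂ × ℂ)) (χ : Fin n → ({w : InfinitePlace L // IsComplex w} → ℂ × ℂ × ℂ) → ℝ),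
        (∀ i, ContDiff ℝ ∞ (χ i)) ∧ (∀ i y, ε (b i) ≤ dist y (b i) → χ i y = 0) ∧ ∀ y ∈ K, ∑ i, χ i y = 1)
    -- (Σ-SUPP) compact class-support of every member of the space
    (hsupp : ∀ Ψ : Finset {w : InfinitePlace L // IsComplex w} → ({w : InfinitePlace L // IsComplex w} → Fin 3 → ℝ) → ℂ, ArchBouazizSpaceH jcH Ψ →
      ∃ K : Set ({w : InfinitePlace L // IsComplex w} → ℂ × ℂ × ℂ), IsCompact K ∧ ∀ (S : Finset {w : InfinitePlace L // IsComplex w}) (c : {w : InfinitePlace L // IsComplex w} → Fin 3 → ℝ), Ψ S c ≠ 0 → bzClassMap S c ∈ K)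
    -- (Σ-MULT) class-function multipliers of genuine families
    (hmult : ∀ F : ({w : InfinitePlace L // IsComplex w} → ℂ × ℂ × ℂ) → ℂ, ContDiff ℝ ∞ F →
      ∀ fH : ↥(arch (↥(maximalRealSubfield L)) L (IsCMField.complexConj L) 2 (Matrix.of fun i j : Fin 2 => if i.val + j.val + 1 = 2 then (1 : L) else 0)) ×
      ↥(arch (↥(maximalRealSubfield L)) L (IsCMField.complexConj L) 1 (Matrix.of fun i j : Fin 1 => if i.val + j.val + 1 = 1 then (1 : L) else 0)) → ℂ,
        ArchSmooth₂ L fH → ∃ fH' : ↥(arch (↥(maximalRealSubfield L)) L (IsCMField.complexConj L) 2 (Matrix.of fun i j : Fin 2 => if i.val + j.val + 1 = 2 then (1 : L) else 0)) ×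
      ↥(arch (↥(maximalRealSubfield L)) L (IsCMField.complexConj L) 1 (Matrix.of fun i j : Fin 1 => if i.val + j.val + 1 = 1 then (1 : L) else 0)) → ℂ,
          ArchSmooth₂ L fH' ∧ ∀ (S : Finset {w : InfinitePlace L // IsComplex w}) (c : {w : InfinitePlace L // IsComplex w} → Fin 3 → ℝ), c ∈ RegS S → stOrbFamH L νH fH' S c = F (bzClassMap S c) * stOrbFamH L νH fH S c)
    -- (Σ-ADD) finite sums of test functions, additivity of `stOrbFamH` on the regular sets
    (hadd : ∀ (n : ℕ) (fHs : Fin n → (↥(arch (↥(maximalRealSubfield L)) L (IsCMField.complexConj L) 2 (Matrix.of fun i j : Fin 2 => if i.val + j.val + 1 = 2 then (1 : L) else 0)) ×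
      ↥(arch (↥(maximalRealSubfield L)) L (IsCMField.complexConj L) 1 (Matrix.of fun i j : Fin 1 => if i.val + j.val + 1 = 1 then (1 : L) else 0)) → ℂ)),
      (∀ i, ArchSmooth₂ L (fHs i)) → ArchSmooth₂ L (∑ i, fHs i) ∧
        ∀ S : Finset {w : InfinitePlace L // IsComplex w}, Set.EqOn (stOrbFamH L νH (∑ i, fHs i) S) (fun c => ∑ i, stOrbFamH L νH (fHs i) S c) (RegS S))
    -- (Σ-REG) local surjectivity, equality form, at a base class with distinct block eigenvalues everywhere
    (hreg : ∀ b : {w : InfinitePlace L // IsComplex w} → ℂ × ℂ × ℂ, (∀ w, (b w).1 ^ 2 ≠ 4 * (b w).2.1) → ∃ ε : ℝ, 0 < ε ∧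
      ∀ Ψ : Finset {w : InfinitePlace L // IsComplex w} → ({w : InfinitePlace L // IsComplex w} → Fin 3 → ℝ) → ℂ, ArchBouazizSpaceH jcH Ψ →
        ∃ fH : ↥(arch (↥(maximalRealSubfield L)) L (IsCMField.complexConj L) 2 (Matrix.of fun i j : Fin 2 => if i.val + j.val + 1 = 2 then (1 : L) else 0)) ×
      ↥(arch (↥(maximalRealSubfield L)) L (IsCMField.complexConj L) 1 (Matrix.of fun i j : Fin 1 => if i.val + j.val + 1 = 1 then (1 : L) else 0)) → ℂ,
          ArchSmooth₂ L fH ∧ ∀ (S : Finset {w : InfinitePlace L // IsComplex w}) (c : {w : InfinitePlace L // IsComplex w} → Fin 3 → ℝ), c ∈ RegS S → dist (bzClassMap S c) b < ε → stOrbFamH L νH fH S c = Ψ S c)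
    -- (Σ-WALL) local surjectivity, equality form, at a wall base class — PRINT (Bouaziz §5.2 + [B1] Thm. 4.1.1; RULING #23)
    (hwall : ∀ b : {w : InfinitePlace L // IsComplex w} → ℂ × ℂ × ℂ, (∃ w, (b w).1 ^ 2 = 4 * (b w).2.1) → ∃ ε : ℝ, 0 < ε ∧
      ∀ Ψ : Finset {w : InfinitePlace L // IsComplex w} → ({w : InfinitePlace L // IsComplex w} → Fin 3 → ℝ) → ℂ, ArchBouazizSpaceH jcH Ψ →
        ∃ fH : ↥(arch (↥(maximalRealSubfield L)) L (IsCMField.complexConj L) 2 (Matrix.of fun i j : Fin 2 => if i.val + j.val + 1 = 2 then (1 : L) else 0)) ×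
      ↥(arch (↥(maximalRealSubfield L)) L (IsCMField.complexConj L) 1 (Matrix.of fun i j : Fin 1 => if i.val + j.val + 1 = 1 then (1 : L) else 0)) → ℂ,
          ArchSmooth₂ L fH ∧ ∀ (S : Finset {w : InfinitePlace L // IsComplex w}) (c : {w : InfinitePlace L // IsComplex w} → Fin 3 → ℝ), c ∈ RegS S → dist (bzClassMap S c) b < ε → stOrbFamH L νH fH S c = Ψ S c)
    (Ψ : Finset {w : InfinitePlace L // IsComplex w} → ({w : InfinitePlace L // IsComplex w} → Fin 3 → ℝ) → ℂ) (hΨ : ArchBouazizSpaceH jcH Ψ) :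
    ∃ fH : ↥(arch (↥(maximalRealSubfield L)) L (IsCMField.complexConj L) 2 (Matrix.of fun i j : Fin 2 => if i.val + j.val + 1 = 2 then (1 : L) else 0)) ×
      ↥(arch (↥(maximalRealSubfield L)) L (IsCMField.complexConj L) 1 (Matrix.of fun i j : Fin 1 => if i.val + j.val + 1 = 1 then (1 : L) else 0)) → ℂ,
      ArchSmooth₂ L fH ∧ ∀ S : Finset {w : InfinitePlace L // IsComplex w}, Set.EqOn (stOrbFamH L νH fH S) (Ψ S) (RegS S) := by
  -- (1) local radii and local pre-images at every base class (regular or wall)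
  have hloc : ∀ b : {w : InfinitePlace L // IsComplex w} → ℂ × ℂ × ℂ, ∃ ε : ℝ, 0 < ε ∧
      ∀ Ψ : Finset {w : InfinitePlace L // IsComplex w} → ({w : InfinitePlace L // IsComplex w} → Fin 3 → ℝ) → ℂ, ArchBouazizSpaceH jcH Ψ →
        ∃ fH : ↥(arch (↥(maximalRealSubfield L)) L (IsCMField.complexConj L) 2 (Matrix.of fun i j : Fin 2 => if i.val + j.val + 1 = 2 then (1 : L) else 0)) ×
      ↥(arch (↥(maximalRealSubfield L)) L (IsCMField.complexConj L) 1 (Matrix.of fun i j : Fin 1 => if i.val + j.val + 1 = 1 then (1 : L) else 0)) → ℂ,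
          ArchSmooth₂ L fH ∧ ∀ (S : Finset {w : InfinitePlace L // IsComplex w}) (c : {w : InfinitePlace L // IsComplex w} → Fin 3 → ℝ), c ∈ RegS S → dist (bzClassMap S c) b < ε → stOrbFamH L νH fH S c = Ψ S c := by
    intro b
    by_cases hb : ∃ w, (b w).1 ^ 2 = 4 * (b w).2.1
    · exact hwall b hb
    · exact hreg b (fun w h => hb ⟨w, h⟩)
  choose ε hε hloc' using hloc
  -- (2) the compact class-support and a finite smooth partition of unity on it
  obtain ⟨K, hK, hKsupp⟩ := hsupp Ψ hΨ
  obtain ⟨n, b, χ, hχ, hχ0, hχ1⟩ := hpou K hK ε hε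
  -- (3) local pre-images and their class-function multiples
  choose fHs hfHs hfeq using fun i => hloc' (b i) Ψ hΨ
  have hF : ∀ i, ContDiff ℝ ∞ (fun Y : {w : InfinitePlace L // IsComplex w} → ℂ × ℂ × ℂ => ((χ i Y : ℝ) : ℂ)) := fun i => ofRealCLM.contDiff.comp (hχ i)
  choose fHs' hfHs' hmul using fun i => hmult (fun Y => ((χ i Y : ℝ) : ℂ)) (hF i) (fHs i) (hfHs i)
  -- (4) the sum
  obtain ⟨hsm, hadd'⟩ := hadd n fHs' hfHs'
  refine ⟨∑ i, fHs' i, hsm, fun S c hc => ?_⟩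
  have h1 := hadd' S hc
  simp only at h1
  rw [h1, Finset.sum_congr rfl fun i _ => hmul i S c hc]
  by_cases hcK : bzClassMap S c ∈ K
  · -- on `K`: every surviving term is `χ_i(class) · Ψ`, and `Σ χ_i = 1`
    have hterm : ∀ i, ((χ i (bzClassMap S c) : ℝ) : ℂ) * stOrbFamH L νH (fHs i) S c = ((χ i (bzClassMap S c) : ℝ) : ℂ) * Ψ S c := by
      intro i
      by_cases hχi : χ i (bzClassMap S c) = 0
      · rw [hχi, Complex.ofReal_zero, zero_mul, zero_mul]
      · have hdist : dist (bzClassMap S c) (b i) < ε (b i) := lt_of_not_ge fun h => hχi (hχ0 i _ h)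
        rw [hfeq i S c hc hdist]
    rw [Finset.sum_congr rfl fun i _ => hterm i, ← Finset.sum_mul, ← Complex.ofReal_sum, hχ1 _ hcK, Complex.ofReal_one, one_mul]
  · -- off `K`: `Ψ S c = 0` and every term vanishes
    have hΨ0 : Ψ S c = 0 := by
      by_contra h
      exact hcK (hKsupp S c h)
    rw [hΨ0]
    refine Finset.sum_eq_zero fun i _ => ?_
    by_cases hχi : χ i (bzClassMap S c) = 0
    · rw [hχi, Complex.ofReal_zero, zero_mul]
    · have hdist : dist (bzClassMap S c) (b i) < ε (b i) := lt_of_not_ge fun h => hχi (hχ0 i _ h)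
      rw [hfeq i S c hc hdist, hΨ0, mul_zero]

end Assembly

end Literature.NumberTheory.Rogawski1990

end
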